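import Summits.HubbardSuperconductivity.HubbardSuperconductivity.Theorems.HyperoctahedralMottCompleteGraphAnchorCAR

/-!
# Route `HyperoctahedralMott`, support `CompleteGraphAnchor` (item stmt-HubbardSuperconductivity-6677):
# algebra of block pair creators

Helper file 4/6: the operators from which the sector minimiser is built. For a block
`S ⊆ Λ` the block creators `C_σ†[S] = Σ_{x∈S} c†_{xσ}` are nilpotent and mutually anticommuting,
so the block pair creator `C↑†[S] C↓†[S]` (an `s`-wave singlet pair delocalised over `S`) is
killed by `C_σ†[S]`, commutes with every creation operator, with `S⁺` and with `S^z`; the same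
holds for products of block pair creators over a list of blocks. The Gutzwiller projector `P`
satisfies `P X = P X P` for all these (`c†` never removes a doublon) and commutes with `S⁺`, `S^z`.
No definitions. [folklore]
-/

-- the mandated namespace `Summit.<Summit>.<Problem>.Theorems` repeats `HubbardSuperconductivity`
-- (single-problem summit, D-0017), which the `dupNamespace` linter flags on every declaration
set_option linter.dupNamespace false

noncomputable section

namespace Summit.HubbardSuperconductivity.HubbardSuperconductivity.Theorems.HyperoctahedralMott.Anchor

open Matrix Finset Literature.MathematicalPhysics.QuantumLattice HubbardWave0
open scoped ComplexOrder

/-! ### The minimiser: algebra of block pair creators -/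

section MinimiserAlgebra

variable {Λ : Type*} [LinearOrder Λ] [Fintype Λ]

/-- A creation operator anticommutes with any sum of creation operators. [folklore] -/
theorem creation_mul_sum_creation (i : Orb Λ) (S : Finset Λ) (σ : Fin 2) :
    creation i * (∑ x ∈ S, creation (orb x σ)) = -((∑ x ∈ S, creation (orb x σ)) * creation i) := by
  rw [Finset.mul_sum, Finset.sum_mul, ← Finset.sum_neg_distrib]
  exact Finset.sum_congr rfl fun x _ => creation_mul_creation_eq_neg _ _

/-- Two sums of creation operators anticommute. [folklore] -/
theorem sum_creation_mul_sum_creation (T : Finset Λ) (τ : Fin 2) (S : Finset Λ) (σ : Fin 2) :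
    (∑ x ∈ T, creation (orb x τ)) * (∑ x ∈ S, creation (orb x σ)) =
      -((∑ x ∈ S, creation (orb x σ)) * (∑ x ∈ T, creation (orb x τ))) := by
  rw [Finset.sum_mul, Finset.mul_sum, ← Finset.sum_neg_distrib]
  exact Finset.sum_congr rfl fun x _ => creation_mul_sum_creation _ _ _

/-- **Nilpotency of the block creator**: `(Σ_{x∈S} c†_{xσ})² = 0`. [folklore] -/
theorem sum_creation_mul_self (S : Finset Λ) (σ : Fin 2) :
    (∑ x ∈ S, creation (orb x σ)) * (∑ x ∈ S, creation (orb x σ)) = 0 := by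
  have h := sum_creation_mul_sum_creation S σ S σ
  have h2 : (2 : ℂ) • ((∑ x ∈ S, creation (orb x σ)) * (∑ x ∈ S, creation (orb x σ))) = 0 := by
    rw [two_smul]
    nth_rewrite 1 [h]
    rw [neg_add_cancel]
  exact (smul_eq_zero.1 h2).resolve_left two_ne_zero

/-- A creation operator commutes with the block pair creator `C↑[S] C↓[S]`. [folklore] -/
theorem creation_mul_pairOn (i : Orb Λ) (S : Finset Λ) :
    creation i * ((∑ x ∈ S, creation (orb x 0)) * (∑ x ∈ S, creation (orb x 1))) =
      ((∑ x ∈ S, creation (orb x 0)) * (∑ x ∈ S, creation (orb x 1))) * creation i := by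
  rw [← mul_assoc, creation_mul_sum_creation, neg_mul, mul_assoc, creation_mul_sum_creation, mul_neg,
    neg_neg, mul_assoc]

/-- A sum of creation operators commutes with the block pair creator. [folklore] -/
theorem sum_creation_mul_pairOn (T : Finset Λ) (τ : Fin 2) (S : Finset Λ) :
    (∑ x ∈ T, creation (orb x τ)) * ((∑ x ∈ S, creation (orb x 0)) * (∑ x ∈ S, creation (orb x 1))) =
      ((∑ x ∈ S, creation (orb x 0)) * (∑ x ∈ S, creation (orb x 1))) * (∑ x ∈ T, creation (orb x τ)) := by
  rw [Finset.sum_mul (s := T), Finset.mul_sum (s := T)]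
  exact Finset.sum_congr rfl fun x _ => creation_mul_pairOn (orb x τ) S

/-- **The block's own creators kill the block pair creator**: `C_σ[S] · C↑[S] C↓[S] = 0`.
[folklore] -/
theorem sum_creation_mul_pairOn_self (S : Finset Λ) (σ : Fin 2) :
    (∑ x ∈ S, creation (orb x σ)) * ((∑ x ∈ S, creation (orb x 0)) * (∑ x ∈ S, creation (orb x 1))) = 0 := by
  have h01 : ∀ ρ : Fin 2, ρ = 0 ∨ ρ = 1 := by decide
  rcases h01 σ with rfl | rfl
  · rw [← mul_assoc, sum_creation_mul_self, zero_mul]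
  · rw [← mul_assoc, sum_creation_mul_sum_creation S 1 S 0, neg_mul, mul_assoc, sum_creation_mul_self,
      mul_zero, neg_zero]

/-- A sum of creation operators commutes with a product of block pair creators. [folklore] -/
theorem sum_creation_mul_blockProd (T : Finset Λ) (τ : Fin 2) (L : List (Finset Λ)) :
    (∑ x ∈ T, creation (orb x τ)) *
        (L.map fun S => (∑ x ∈ S, creation (orb x 0)) * (∑ x ∈ S, creation (orb x 1))).prod =
      (L.map fun S => (∑ x ∈ S, creation (orb x 0)) * (∑ x ∈ S, creation (orb x 1))).prod *
        (∑ x ∈ T, creation (orb x τ)) := by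
  induction L with
  | nil => simp
  | cons S L ih =>
    rw [List.map_cons, List.prod_cons, ← mul_assoc, sum_creation_mul_pairOn, mul_assoc, ih, ← mul_assoc]

/-- **A listed block's creators kill the whole product of block pair creators.** [folklore] -/
theorem sum_creation_mul_blockProd_eq_zero {S : Finset Λ} {L : List (Finset Λ)} (hS : S ∈ L)
    (σ : Fin 2) :
    (∑ x ∈ S, creation (orb x σ)) *
        (L.map fun S => (∑ x ∈ S, creation (orb x 0)) * (∑ x ∈ S, creation (orb x 1))).prod = 0 := by
  induction L with
  | nil => simp at hS
  | cons S' L ih =>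
    rw [List.map_cons, List.prod_cons]
    rcases List.mem_cons.1 hS with rfl | h
    · rw [← mul_assoc, sum_creation_mul_pairOn_self, zero_mul]
    · rw [← mul_assoc, sum_creation_mul_pairOn, mul_assoc, ih h, mul_zero]

/-! #### `S⁺` -/

/-- `S⁺ c†_{xσ} = c†_{xσ} S⁺ + [σ = ↓] c†_{x↑}`. [folklore] -/
theorem spinPlus_mul_creation (x : Λ) (σ : Fin 2) :
    spinPlus * creation (orb x σ) =
      creation (orb x σ) * spinPlus + if σ = 1 then creation (orb x 0) else 0 := by
  rw [spinPlus, Finset.sum_mul, Finset.mul_sum]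
  have h : ∀ w : Λ, creation (orb w 0) * annihilation (orb w 1) * creation (orb x σ) =
      creation (orb x σ) * (creation (orb w 0) * annihilation (orb w 1)) +
        if orb w 1 = orb x σ then creation (orb w 0) else 0 := by
    intro w
    rw [mul_assoc, annihilation_mul_creation, mul_sub, mul_ite, mul_one, mul_zero, ← mul_assoc,
      creation_mul_creation_eq_neg (orb w 0) (orb x σ), neg_mul, sub_neg_eq_add, add_comm, mul_assoc]
  rw [Finset.sum_congr rfl fun w _ => h w, Finset.sum_add_distrib]
  congr 1
  by_cases hσ : σ = 1
  · subst hσ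
    rw [if_pos rfl, Finset.sum_eq_single x]
    · rw [if_pos rfl]
    · intro w _ hw
      rw [if_neg (fun h => hw (orb_inj.1 h).1)]
    · exact fun h => absurd (Finset.mem_univ x) h
  · rw [if_neg hσ]
    exact Finset.sum_eq_zero fun w _ => if_neg fun h => hσ (orb_inj.1 h).2.symm

/-- `S⁺` commutes with `C↑[S]`. [folklore] -/
theorem spinPlus_mul_sum_creation_up (S : Finset Λ) :
    spinPlus * (∑ x ∈ S, creation (orb x 0)) = (∑ x ∈ S, creation (orb x 0)) * spinPlus := by
  rw [Finset.mul_sum, Finset.sum_mul]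
  exact Finset.sum_congr rfl fun x _ => by
    rw [spinPlus_mul_creation, if_neg (show (0 : Fin 2) ≠ 1 by decide), add_zero]

/-- `S⁺ C↓[S] = C↓[S] S⁺ + C↑[S]`. [folklore] -/
theorem spinPlus_mul_sum_creation_down (S : Finset Λ) :
    spinPlus * (∑ x ∈ S, creation (orb x 1)) =
      (∑ x ∈ S, creation (orb x 1)) * spinPlus + ∑ x ∈ S, creation (orb x 0) := by
  rw [Finset.mul_sum, Finset.sum_mul, ← Finset.sum_add_distrib]
  exact Finset.sum_congr rfl fun x _ => by rw [spinPlus_mul_creation, if_pos rfl]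

/-- `S⁺` commutes with the block pair creator (the extra term is `C↑[S]² = 0`). [folklore] -/
theorem spinPlus_mul_pairOn (S : Finset Λ) :
    spinPlus * ((∑ x ∈ S, creation (orb x 0)) * (∑ x ∈ S, creation (orb x 1))) =
      ((∑ x ∈ S, creation (orb x 0)) * (∑ x ∈ S, creation (orb x 1))) * spinPlus := by
  rw [← mul_assoc, spinPlus_mul_sum_creation_up, mul_assoc, spinPlus_mul_sum_creation_down, mul_add,
    sum_creation_mul_self, add_zero, mul_assoc]

/-- `S⁺` commutes with a product of block pair creators. [folklore] -/
theorem spinPlus_mul_blockProd (L : List (Finset Λ)) :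
    spinPlus * (L.map fun S => (∑ x ∈ S, creation (orb x 0)) * (∑ x ∈ S, creation (orb x 1))).prod =
      (L.map fun S => (∑ x ∈ S, creation (orb x 0)) * (∑ x ∈ S, creation (orb x 1))).prod * spinPlus := by
  induction L with
  | nil => simp
  | cons S L ih =>
    rw [List.map_cons, List.prod_cons, ← mul_assoc, spinPlus_mul_pairOn, mul_assoc, ih, ← mul_assoc]

/-! #### `S^z` -/

/-- `n_{wτ} c†_{xσ} = c†_{xσ} n_{wτ} + δ c†_{xσ}`. [folklore] -/
theorem numberOp_mul_creation (w x : Λ) (τ σ : Fin 2) :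
    numberOp w τ * creation (orb x σ) =
      creation (orb x σ) * numberOp w τ + if orb w τ = orb x σ then creation (orb x σ) else 0 := by
  by_cases h : orb w τ = orb x σ
  · rw [if_pos h, numberOp, h, number_mul_creation_self, creation_mul_number_self, zero_add]
  · rw [if_neg h, add_zero, numberOp, number_mul_creation_of_ne h]

/-- `S^z c†_{x↑} = c†_{x↑} (S^z + ½)`. [folklore] -/
theorem spinZ_mul_creation_up (x : Λ) :
    spinZ * creation (orb x 0) = creation (orb x 0) * spinZ + (1 / 2 : ℂ) • creation (orb x 0) := by
  rw [spinZ, smul_mul_assoc, mul_smul_comm, ← smul_add, Finset.sum_mul, Finset.mul_sum]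
  congr 1
  have h : ∀ w : Λ, (numberOp w 0 - numberOp w 1) * creation (orb x 0) =
      creation (orb x 0) * (numberOp w 0 - numberOp w 1) +
        if orb w 0 = orb x 0 then creation (orb x 0) else 0 := by
    intro w
    rw [sub_mul, numberOp_mul_creation, numberOp_mul_creation,
      if_neg (show orb w 1 ≠ orb x 0 from fun h => absurd (orb_inj.1 h).2 (by decide)), add_zero,
      mul_sub]
    abel
  rw [Finset.sum_congr rfl fun w _ => h w, Finset.sum_add_distrib]
  congr 1
  rw [Finset.sum_eq_single x, if_pos rfl]
  · intro w _ hw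
    exact if_neg fun h => hw (orb_inj.1 h).1
  · exact fun h => absurd (Finset.mem_univ x) h

/-- `S^z c†_{x↓} = c†_{x↓} (S^z - ½)`. [folklore] -/
theorem spinZ_mul_creation_down (x : Λ) :
    spinZ * creation (orb x 1) = creation (orb x 1) * spinZ - (1 / 2 : ℂ) • creation (orb x 1) := by
  rw [spinZ, smul_mul_assoc, mul_smul_comm, ← smul_sub, Finset.sum_mul, Finset.mul_sum]
  congr 1
  have h : ∀ w : Λ, (numberOp w 0 - numberOp w 1) * creation (orb x 1) =
      creation (orb x 1) * (numberOp w 0 - numberOp w 1) -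
        if orb w 1 = orb x 1 then creation (orb x 1) else 0 := by
    intro w
    rw [sub_mul, numberOp_mul_creation, numberOp_mul_creation,
      if_neg (show orb w 0 ≠ orb x 1 from fun h => absurd (orb_inj.1 h).2 (by decide)), add_zero,
      mul_sub]
    abel
  rw [Finset.sum_congr rfl fun w _ => h w, Finset.sum_sub_distrib]
  congr 1
  rw [Finset.sum_eq_single x, if_pos rfl]
  · intro w _ hw
    exact if_neg fun h => hw (orb_inj.1 h).1
  · exact fun h => absurd (Finset.mem_univ x) h

/-- `S^z C↑[S] = C↑[S] (S^z + ½)`. [folklore] -/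
theorem spinZ_mul_sum_creation_up (S : Finset Λ) :
    spinZ * (∑ x ∈ S, creation (orb x 0)) =
      (∑ x ∈ S, creation (orb x 0)) * spinZ + (1 / 2 : ℂ) • ∑ x ∈ S, creation (orb x 0) := by
  rw [Finset.mul_sum, Finset.sum_mul, Finset.smul_sum, ← Finset.sum_add_distrib]
  exact Finset.sum_congr rfl fun x _ => spinZ_mul_creation_up x

/-- `S^z C↓[S] = C↓[S] (S^z - ½)`. [folklore] -/
theorem spinZ_mul_sum_creation_down (S : Finset Λ) :
    spinZ * (∑ x ∈ S, creation (orb x 1)) =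
      (∑ x ∈ S, creation (orb x 1)) * spinZ - (1 / 2 : ℂ) • ∑ x ∈ S, creation (orb x 1) := by
  rw [Finset.mul_sum, Finset.sum_mul, Finset.smul_sum, ← Finset.sum_sub_distrib]
  exact Finset.sum_congr rfl fun x _ => spinZ_mul_creation_down x

/-- `S^z` commutes with the (spin-zero) block pair creator. [folklore] -/
theorem spinZ_mul_pairOn (S : Finset Λ) :
    spinZ * ((∑ x ∈ S, creation (orb x 0)) * (∑ x ∈ S, creation (orb x 1))) =
      ((∑ x ∈ S, creation (orb x 0)) * (∑ x ∈ S, creation (orb x 1))) * spinZ := by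
  rw [← mul_assoc, spinZ_mul_sum_creation_up, add_mul, mul_assoc, spinZ_mul_sum_creation_down, mul_sub,
    smul_mul_assoc, mul_smul_comm, ← mul_assoc]
  abel

/-- `S^z` commutes with a product of block pair creators. [folklore] -/
theorem spinZ_mul_blockProd (L : List (Finset Λ)) :
    spinZ * (L.map fun S => (∑ x ∈ S, creation (orb x 0)) * (∑ x ∈ S, creation (orb x 1))).prod =
      (L.map fun S => (∑ x ∈ S, creation (orb x 0)) * (∑ x ∈ S, creation (orb x 1))).prod * spinZ := by
  induction L with
  | nil => simp
  | cons S L ih =>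
    rw [List.map_cons, List.prod_cons, ← mul_assoc, spinZ_mul_pairOn, mul_assoc, ih, ← mul_assoc]

/-! #### The Gutzwiller projector and creation: doublons are never removed -/

/-- `P c† = P c† P`: creating an electron never removes a doublon. [folklore] -/
theorem gutzwillerProj_mul_creation_eq (i : Orb Λ) :
    (gutzwillerProj : Matrix (Finset (Orb Λ)) (Finset (Orb Λ)) ℂ) * creation i =
      gutzwillerProj * creation i * gutzwillerProj := by
  ext s t
  rw [Matrix.mul_assoc, gutzwillerProj, diagonal_mul, diagonal_mul, mul_diagonal, creation_apply]
  by_cases h : i ∉ t ∧ s = insert i t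
  · rw [if_pos h]
    by_cases hs : HasDoubleOccupancy s
    · simp [hs]
    · have ht : ¬ HasDoubleOccupancy t := fun ⟨z, hz0, hz1⟩ =>
        hs ⟨z, h.2 ▸ Finset.mem_insert_of_mem hz0, h.2 ▸ Finset.mem_insert_of_mem hz1⟩
      simp [hs, ht]
  · rw [if_neg h]
    simp

/-- Closure of `P X = P X P` under products. [folklore] -/
theorem proj_mul_eq_of_mul {X Y : Matrix (Finset (Orb Λ)) (Finset (Orb Λ)) ℂ}
    (hX : gutzwillerProj * X = gutzwillerProj * X * gutzwillerProj)
    (hY : gutzwillerProj * Y = gutzwillerProj * Y * gutzwillerProj) :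
    gutzwillerProj * (X * Y) = gutzwillerProj * (X * Y) * gutzwillerProj := by
  set P : Matrix (Finset (Orb Λ)) (Finset (Orb Λ)) ℂ := gutzwillerProj
  calc P * (X * Y) = P * X * Y := by rw [Matrix.mul_assoc]
    _ = P * X * P * Y := by rw [← hX]
    _ = P * X * (P * Y) := by rw [Matrix.mul_assoc (P * X) P Y]
    _ = P * X * (P * Y * P) := by rw [← hY]
    _ = P * X * P * Y * P := by simp only [Matrix.mul_assoc]
    _ = P * X * Y * P := by rw [← hX]
    _ = P * (X * Y) * P := by rw [Matrix.mul_assoc P X Y]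

/-- Closure of `P X = P X P` under sums. [folklore] -/
theorem proj_mul_eq_of_sum {ι' : Type*} (s : Finset ι') (f : ι' → Matrix (Finset (Orb Λ)) (Finset (Orb Λ)) ℂ)
    (h : ∀ i ∈ s, gutzwillerProj * f i = gutzwillerProj * f i * gutzwillerProj) :
    gutzwillerProj * (∑ i ∈ s, f i) = gutzwillerProj * (∑ i ∈ s, f i) * gutzwillerProj := by
  rw [Finset.mul_sum, Finset.sum_mul]
  exact Finset.sum_congr rfl fun i hi => h i hi

/-- `P C↑[S] C↓[S] = P C↑[S] C↓[S] P`. [folklore] -/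
theorem gutzwillerProj_mul_pairOn_eq (S : Finset Λ) :
    gutzwillerProj * ((∑ x ∈ S, creation (orb x 0)) * (∑ x ∈ S, creation (orb x 1))) =
      gutzwillerProj * ((∑ x ∈ S, creation (orb x 0)) * (∑ x ∈ S, creation (orb x 1))) * gutzwillerProj :=
  proj_mul_eq_of_mul (proj_mul_eq_of_sum _ _ fun _ _ => gutzwillerProj_mul_creation_eq _)
    (proj_mul_eq_of_sum _ _ fun _ _ => gutzwillerProj_mul_creation_eq _)

/-- `P F = P F P` for a product `F` of block pair creators. [folklore] -/
theorem gutzwillerProj_mul_blockProd_eq (L : List (Finset Λ)) :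
    gutzwillerProj * (L.map fun S => (∑ x ∈ S, creation (orb x 0)) * (∑ x ∈ S, creation (orb x 1))).prod =
      gutzwillerProj * (L.map fun S => (∑ x ∈ S, creation (orb x 0)) * (∑ x ∈ S, creation (orb x 1))).prod *
        gutzwillerProj := by
  induction L with
  | nil => simp [gutzwillerProj_mul_self]
  | cons S L ih =>
    rw [List.map_cons, List.prod_cons]
    exact proj_mul_eq_of_mul (gutzwillerProj_mul_pairOn_eq S) ih

/-- The Gutzwiller projector commutes with every same-site spin flip `c†_{w↑} c_{w↓}`. [folklore] -/
theorem gutzwillerProj_mul_flip (w : Λ) :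
    (gutzwillerProj : Matrix (Finset (Orb Λ)) (Finset (Orb Λ)) ℂ) * (creation (orb w 0) * annihilation (orb w 1)) =
      creation (orb w 0) * annihilation (orb w 1) * gutzwillerProj := by
  ext s t
  rw [gutzwillerProj, diagonal_mul, mul_diagonal, LiebThm1.creation_mul_annihilation_apply]
  by_cases h : orb w 0 ∈ s ∧ orb w 1 ∉ s.erase (orb w 0) ∧ t = insert (orb w 1) (s.erase (orb w 0))
  · rw [if_pos h]
    obtain ⟨h0, h1, rfl⟩ := h
    have h01 : orb w 1 ≠ orb w 0 := (EtaPairingODLRO.orb_zero_ne_orb_one w).symm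
    have h1s : orb w 1 ∉ s := fun h => h1 (Finset.mem_erase.2 ⟨h01, h⟩)
    have key : HasDoubleOccupancy s ↔ HasDoubleOccupancy (insert (orb w 1) (s.erase (orb w 0))) := by
      constructor
      · rintro ⟨z, hz0, hz1⟩
        have hz : z ≠ w := by rintro rfl; exact h1s hz1
        exact ⟨z, Finset.mem_insert_of_mem (Finset.mem_erase.2 ⟨fun h => hz (orb_inj.1 h).1, hz0⟩),
          Finset.mem_insert_of_mem (Finset.mem_erase.2 ⟨fun h => hz (orb_inj.1 h).1, hz1⟩)⟩
      · rintro ⟨z, hz0, hz1⟩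
        rcases Finset.mem_insert.1 hz0 with e | hz0'
        · exact absurd (orb_inj.1 e).2 (by decide)
        · have hz : z ≠ w := fun e => by
            rw [e] at hz0'
            exact (Finset.mem_erase.1 hz0').1 rfl
          rcases Finset.mem_insert.1 hz1 with e | hz1'
          · exact absurd (orb_inj.1 e).1 hz
          · exact ⟨z, (Finset.mem_erase.1 hz0').2, (Finset.mem_erase.1 hz1').2⟩
    by_cases hs : HasDoubleOccupancy s
    · rw [if_pos hs, if_pos (key.1 hs), zero_mul, mul_zero]
    · rw [if_neg hs, if_neg (fun h => hs (key.2 h)), one_mul, mul_one]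
  · rw [if_neg h, mul_zero, zero_mul]

/-- The Gutzwiller projector commutes with `S⁺`. [folklore] -/
theorem gutzwillerProj_mul_spinPlus :
    (gutzwillerProj : Matrix (Finset (Orb Λ)) (Finset (Orb Λ)) ℂ) * spinPlus = spinPlus * gutzwillerProj := by
  rw [spinPlus, Finset.mul_sum, Finset.sum_mul]
  exact Finset.sum_congr rfl fun w _ => gutzwillerProj_mul_flip w

/-- The Gutzwiller projector commutes with `S^z` (both are diagonal), on vectors. [folklore] -/
theorem spinZ_mulVec_gutzwillerProj_mulVec (v : Fock (Orb Λ)) :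
    spinZ *ᵥ (gutzwillerProj *ᵥ v) = gutzwillerProj *ᵥ (spinZ *ᵥ v) := by
  funext s
  rw [NagaokaTasaki.spinZ_mulVec_apply, NagaokaTasaki.gutzwillerProj_mulVec_apply,
    NagaokaTasaki.gutzwillerProj_mulVec_apply, NagaokaTasaki.spinZ_mulVec_apply]
  split_ifs <;> simp

/-! #### Particle number -/

omit [Fintype Λ] in
/-- An occupation basis vector has the particle number of its configuration. [folklore] -/
theorem isNParticle_single {s : Finset (Orb Λ)} {m : ℕ} (h : s.card = m) :
    IsNParticle m (Pi.single s (1 : ℂ)) := fun t ht =>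
  Pi.single_eq_of_ne (fun h' : t = s => ht (by rw [h', h])) _

/-- A block creator raises the particle number by one. [folklore] -/
theorem isNParticle_sum_creation_mulVec {m : ℕ} {v : Fock (Orb Λ)} (hv : IsNParticle m v)
    (S : Finset Λ) (σ : Fin 2) :
    IsNParticle (m + 1) ((∑ x ∈ S, creation (orb x σ)) *ᵥ v) := by
  rw [sum_mulVec]
  have h : ∀ x ∈ S, creation (orb x σ) *ᵥ v ∈ nParticleSubmodule (m + 1) := fun x _ =>
    IsNParticle.creation_mulVec_holds hv _
  exact (Submodule.sum_mem _ h : _ ∈ nParticleSubmodule (m + 1))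

/-- A product of block pair creators raises the particle number by twice its length. [folklore] -/
theorem isNParticle_blockProd_mulVec {m : ℕ} {v : Fock (Orb Λ)} (hv : IsNParticle m v)
    (L : List (Finset Λ)) :
    IsNParticle (m + 2 * L.length)
      ((L.map fun S => (∑ x ∈ S, creation (orb x 0)) * (∑ x ∈ S, creation (orb x 1))).prod *ᵥ v) := by
  induction L with
  | nil => simpa using hv
  | cons S L ih =>
    rw [List.map_cons, List.prod_cons, ← mulVec_mulVec, ← mulVec_mulVec, List.length_cons,
      show m + 2 * (L.length + 1) = m + 2 * L.length + 1 + 1 by ring]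
    exact isNParticle_sum_creation_mulVec (isNParticle_sum_creation_mulVec ih S 1) S 0

/-- The Gutzwiller projector preserves the particle number. [folklore] -/
theorem isNParticle_gutzwillerProj_mulVec {m : ℕ} {v : Fock (Orb Λ)} (hv : IsNParticle m v) :
    IsNParticle m (gutzwillerProj *ᵥ v) := fun s hs => by
  rw [NagaokaTasaki.gutzwillerProj_mulVec_apply]
  split_ifs
  · rfl
  · exact hv s hs

end MinimiserAlgebra

end Summit.HubbardSuperconductivity.HubbardSuperconductivity.Theorems.HyperoctahedralMott.Anchor
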